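import Summits.MatrixMultiplication.MatrixMultiplication.Theorems.SoloInformedCyclicModel

/-!
# One fibre is not enough: the one-fibre form of Lemma L fails

This work, §8.7. In the coprime case of Conjecture C3 a realization of `⟨n,n,n⟩` in a translation
scheme with one involutory multiplier splits into an untwisted chart `F⁰(i,j,k) = fᵢ + gⱼ + lₖ` on the
fixed part `S⁰` and sign-twisted data `a, b, c` on the fixed-point-free part `S¹`, subject to the
triangle equations (E) on ALL index triples and SEPARATION (Sep) on the pairs of distinct triples inside
one fibre of `F⁰`. §8.4 proposed

  LEMMA L (one-fibre form): (E) on all triples + (Sep) on one partial-Latin fibre `Λ`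
  `⟹ #sign-classes of S¹ ≥ |Λ| / C`.

It is FALSE. Take `S¹ = ℤ/3` (multipliers `±1`) and the support data
`a(i,j) = [i ≠ j]`, `b(j,k) = [j ≠ k]`, `c(k,i) = [k ≠ i]`: a twisted triangle `a ± b ± c = 0` exists
iff NOT exactly one of the three values is nonzero, so (E) holds on every triple (`toy_eqn`), and the
DIAGONAL `Λ = {(t,t,t)}` — a partial Latin square of size `n`, a fibre of the flat chart
`(i,j,k) ↦ (xᵢ - xₖ, yⱼ - yₖ)` — is separated (`toy_sep_diagonal`): `|Λ| = n` with only TWO sign classes.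
The same data separate no two triples with pairwise distinct coordinates (`toy_generic_inseparable`), so
a realization carrying them still has `|S⁰| ≥ n(n-1)(n-2)`: the loss is in the fibre-by-fibre
REDUCTION, not in C3. Consequence (§8.7): Lemma L must be global — `#fibres · #classes ≥ n³/C` — and the
cyclic-model theorems (`CyclicModel`, Sep on all fibres) are unaffected. References: this work §8;
CohnUmans2013 (arXiv:1207.6528) Def. 12.
-/

namespace Summit.MatrixMultiplication.MatrixMultiplication.Theorems.TwistedTPP

namespace OneFibreToy

variable {G : Type*} [DecidableEq G]

/-- `S¹`-component of the first class map of the toy: `a(i,j) = [i ≠ j] ∈ ℤ/3`. [this work, §8.7] -/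
def toyA (i j : G) : ZMod 3 := if i = j then 0 else 1
/-- `b(j,k) = [j ≠ k] ∈ ℤ/3`. [this work, §8.7] -/
def toyB (j k : G) : ZMod 3 := if j = k then 0 else 1
/-- `c(k,i) = [k ≠ i] ∈ ℤ/3`. [this work, §8.7] -/
def toyC (k i : G) : ZMod 3 := if k = i then 0 else 1

/-- **(E) holds on every triple**: some sign pattern solves `a(i,j) ± b(j,k) ± c(k,i) = 0`
(the number of nonzero terms is `0, 2` or `3`, never `1`). [this work, §8.7] -/
theorem toy_eqn (i j k : G) :
    toyA i j + toyB j k + toyC k i = 0 ∨ toyA i j + toyB j k - toyC k i = 0 ∨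
    toyA i j - toyB j k + toyC k i = 0 ∨ toyA i j - toyB j k - toyC k i = 0 := by
  unfold toyA toyB toyC
  by_cases hij : i = j
  · subst hij
    by_cases hik : i = k
    · subst hik
      simp
    · have hki : ¬ k = i := fun h => hik h.symm
      simp only [if_true, hik, hki, if_false]
      decide
  · by_cases hjk : j = k
    · subst hjk
      have hji : ¬ j = i := fun h => hij h.symm
      simp only [hij, hji, if_false, if_true]
      decide
    · by_cases hki : k = i
      · subst hki
        simp only [hij, hjk, if_false, if_true]
        decide
      · simp only [hij, hjk, hki, if_false]
        decide

/-- **(Sep) holds on the diagonal fibre** `{(t,t,t)}`: for `s ≠ t` no sign pattern solves the mixed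
equation `a(s,s) ± b(t,s) ± c(t,t) = 0` (the mixed cells of the pair `((s,s,s),(t,t,t))` are
`(s,s), (t,s), (t,t)`). A partial-Latin fibre of size `n` separated with two sign classes.
[this work, §8.7] -/
theorem toy_sep_diagonal {s t : G} (hst : s ≠ t) :
    toyA s s + toyB t s + toyC t t ≠ 0 ∧ toyA s s + toyB t s - toyC t t ≠ 0 ∧
    toyA s s - toyB t s + toyC t t ≠ 0 ∧ toyA s s - toyB t s - toyC t t ≠ 0 := by
  unfold toyA toyB toyC
  have hts : ¬ t = s := fun h => hst h.symm
  simp only [if_true, hts, if_false]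
  decide

/-- **The flip side**: two triples whose `a`-cell `(i,j)` and `c`-cell `(k',i')` are off-diagonal are
NEVER separated — some pattern solves `a(i,j) ± b(j',k) ± c(k',i') = 0`. So every triple with
pairwise distinct coordinates is alone in its fibre and a realization carrying the toy data has
`|S⁰| ≥ n(n-1)(n-2)`. [this work, §8.7] -/
theorem toy_generic_inseparable {i j k i' j' k' : G} (hij : i ≠ j) (hki : k' ≠ i') :
    toyA i j + toyB j' k + toyC k' i' = 0 ∨ toyA i j + toyB j' k - toyC k' i' = 0 := by
  unfold toyA toyB toyC
  by_cases hjk : j' = k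
  · simp only [hij, hki, hjk, if_false, if_true]
    decide
  · simp only [hij, hki, hjk, if_false]
    decide

/-- The diagonal is a genuine fibre of a flat (untwisted) chart: with `F⁰(i,j,k) = (i - k, j - k)`
in `G × G` (`fᵢ = (i,0)`, `gⱼ = (0,j)`, `lₖ = (-k,-k)`), `F⁰ = 0` exactly on the diagonal.
[this work, §8.7] -/
theorem diagonal_is_fibre {H : Type*} [AddCommGroup H] (i j k : H) :
    ((i, (0 : H)) + ((0 : H), j) + (-k, -k) = (0 : H × H)) ↔ (i = k ∧ j = k) := by
  simp only [Prod.mk_add_mk, add_zero, zero_add, Prod.mk_eq_zero, ← sub_eq_add_neg, sub_eq_zero]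

end OneFibreToy

end Summit.MatrixMultiplication.MatrixMultiplication.Theorems.TwistedTPP
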